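import Literature.MathematicalPhysics.QuantumFieldTheory.Balaban1983to89.B3WT226Pairings

/-!
# `Balaban1983to89.B3WT226Derivative` — T. Bałaban, *(Higgs)₂,₃ quantum fields in a finite volume. III. Renormalization*,
# Commun. Math. Phys. **88** (1983) 411–445 [Balaban1983Higgs3], (2.26) p. 431, LEFT MEMBER: the `A`-derivative of the
# Ward–Takahashi identity (2.24) at `A = 0`, `F = 1`, ON THE CONCRETE LATTICE MODEL (file 2/2 of R11 part 2a)

statement-level skeleton of published theorems with citation tags; proofs where landed; nothing here is a claim about the Yang–Mills mass gap

PDF held: `paper:balaban1983-higgs-2-3-quantum-fields-finite-volume` (journal page = PDF page + 410); p. 431 read AS AN IMAGE on the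
×2 render `run/shared/lean/pub/pub-balaban/b2b-balaban-ref1/pages/1983-cmp88-higgs23-III/1983-cmp88-higgs23-III-p021-x2.png`.

WHAT IS REPRODUCED.  SKELETON row **B3.Eq2.26-2.28** (`run/shared/lean/pub/lit-balaban/SKELETON.md`, absent: *"worked WT
identities: F = 1, one A-derivative at A = 0 using (2.25): the four-term identity (2.26) …"*).  Page 431, verbatim: *"Taking F = 1,
differentiating with respect to A and next taking A = 0 and using the identity (2.25), we get*
  `∫dμ_{C^η_{M²}}(φ)[(−e_k⟨∂^ηφ, Aqφ⟩)(:⟨∂^ηφ, ∂^ηλqφ⟩:) − e_k⟨φ, A·∂^ηλq²φ⟩ − e_k⟨∂^ηφ, ηA∂^ηλq²φ⟩]`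
  `= −e_kΣ_{b,b'}η^{2d}A_b tr q(C^η_{M²}∂^{η*})(b₋,b')q(C^η_{M²}∂^{η*})(b'₋,b)(∂^ηλ)(b') + e_kΣ_{b,b'}η^{2d}A_b tr qC^η_{M²}(b₋,b'₋)q(∂^ηC^η_{M²}∂^{η*})(b',b)(∂^ηλ)(b')`
  `− e_kΣ_bη^dA_b(∂^ηλ)(b) tr q²C^η_{M²}(0) − e_kΣ_bη^dηA_b(∂^ηλ)(b) tr q²(C^η_{M²}∂^η)(b₋,b) = 0, (2.26)"*.
THIS FILE proves, for the lattice model of `…B3WT223Instance`/`…B3WT224Instance` (fields `φ : T^{(j)} → R^N`, Lebesgue `dφ`,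
`U(A) = exp(qηeA)` of B1 (1.7), weight `w = η^d`, lattice factor `c = η⁻¹`, mass `M²`), that the LEFT MEMBER VANISHES:
  `∫dμ_{C^η_{M²}}(φ)[(−cηe⟨∂^ηφ, Bqφ⟩)(:⟨∂^ηφ, ∂^ηλqφ⟩:) − cηe⟨φ, B·∂^ηλq²φ⟩ − ηe⟨∂^ηφ, B∂^ηλq²φ⟩] = 0`   (`eq226_left`)
for every direction `B` of the vector field (print: `A`; `cη = 1` in print), by EXACTLY the printed route: (2.24) with `F = 1` along
the backgrounds `A = sB` (`B3WT224Instance.eq224`, every `s`), differentiated at `s = 0` under the integral sign (dominated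
convergence with the Gaussian majorant `B3WT224Instance.integrable_explin_mul_gauss`), the derivative of the identically vanishing
family being `0` (`B3Sect2StatementsPart2.deriv_eq_zero_of_invariant` BY NAME), and the normal ordering `:⟨∂^ηφ,∂^ηλqφ⟩: =
⟨∂^ηφ,∂^ηλqφ⟩ − ∫dμ_C⟨∂^ηφ,∂^ηλqφ⟩` discharged *"using the identity (2.25)"* (`B3WT224Instance.eq225`).  The three terms are the
COMPUTED derivatives of file 1/2 (`B3WT226Pairings.hasDerivAt_weight_lin`, `hasDerivAt_pairDA_lin`, `pairDAdot_zero`).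
NOT REPRODUCED (stays free under the PHASE2-TARGETS stem `B3WTInstances226.lean`): the RIGHT member of (2.26) — the evaluation of
the three Gaussian integrals as the four trace terms over the kernels of `C^η_{M²} = (−Δ^η+M²)⁻¹`, `C^η_{M²}∂^{η*}`, `∂^ηC^η_{M²}∂^{η*}`
(Wick's theorem for the model) — and the pictures (2.27)/(2.28).
Phase-2 RESERVE R11 (part 2a) of `PHASE2-TARGETS.md` §G.3; cell `lit-balaban`, seat p39 (gen 2, unit `lit-balaban-p39`), HOME
`run/shared/lean/pub/lit-balaban/`.  Nothing beyond these lattice identities is asserted; no new `Prop` is introduced.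
-/

noncomputable section

open scoped BigOperators InnerProductSpace

namespace Literature.MathematicalPhysics.QuantumFieldTheory.Balaban1983to89.B3WT226Derivative

open _root_.MeasureTheory
open LatticeFieldCalculus B3WT223Instance B3WT224Instance B3WT226Pairings

variable {P : Params} {j N : ℕ} (C : HiggsLattice.ChargeData N) (η w c M2 : ℝ)

/-! ## §5 (2.26), left member, for the lattice model -/

/-- **The `A`-derivative of (2.24) at `A = 0`, `F = 1`** (p. 431: *"Taking F = 1, differentiating with respect to A and next taking
A = 0"*), as an unnormalized Gaussian integral and before the normal ordering is inserted:
`∫dφ e^{−½⟨φ,(−Δ^η+M²)φ⟩}[(−cηe⟨∂^ηφ,Bqφ⟩)⟨∂^ηφ,∂^ηλqφ⟩ − cηe⟨φ,B·∂^ηλq²φ⟩ − ηe⟨∂^ηφ,B∂^ηλq²φ⟩] = 0` for every direction `B`,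
gauge function `λ`, `η^d = w > 0`, `M² > 0`, charged coupling `cηe ≠ 0`.  Proof = the printed route: `s ↦ ∫dφ e^{−½⟨φ,(−Δ_{sB}+M²)φ⟩}
⟨D_{sB}φ,∂λqφ⟩` vanishes identically by (2.24) with `F = 1` (`B3WT224Instance.eq224`), is differentiable at `s = 0` under the
integral sign (dominated convergence, Gaussian majorant `B3WT224Instance.integrable_explin_mul_gauss`) with the derivative computed
in §3, and `B3Sect2StatementsPart2.deriv_eq_zero_of_invariant` (BY NAME) makes that derivative `0`; §2 (`pairJ_zero`,
`B3WT224Instance.pairDA_zero`, `pairDAdot_zero`) rewrites it into the three printed terms. [cite: Balaban1983Higgs3, (2.26) p.431] -/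
theorem eq226_deriv (hw : 0 < w) (hM : 0 < M2) (hce : c * η * C.e ≠ 0) (B : VecField P j ℝ) (lam : Site P j → ℝ) :
    ∫ φ, weight C η w c M2 (0 : VecField P j ℝ) φ *
      ((-(c * η * C.e) * curJ C w c B φ) * pairD C w c lam φ - (c * η * C.e) * locQ C w c B lam φ
        - (η * C.e) * derQ C w c B lam φ) = 0 := by
  -- the family `G s = e^{−½⟨φ,(−Δ_{sB}+M²)φ⟩}⟨D_{sB}φ, ∂λqU(sB)φ⟩` and its `s`-derivative `G'`
  set G : ℝ → Cfg P j N → ℝ := fun s φ => weight C η w c M2 (s • B) φ * pairDA C η w c (s • B) lam φ with hG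
  set G' : ℝ → Cfg P j N → ℝ := fun s φ =>
    -(c * η * C.e) * (weight C η w c M2 (s • B) φ * pairJ C η w c (s • B) B φ) * pairDA C η w c (s • B) lam φ
      + weight C η w c M2 (s • B) φ * pairDAdot C η w c (s • B) B lam φ with hG'
  -- (2.24) with F = 1: the family of integrals vanishes identically, in particular it is constant
  have hzero_s : ∀ s : ℝ, ∫ φ, G s φ = 0 := fun s => by
    have h := eq224 C η w c M2 hw hM hce (s • B) lam (fun _ => (1 : ℝ)) (fun _ _ => rfl) continuous_const
      ⟨1, 0, fun _ => by simp⟩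
    simpa only [hG, one_mul] using h
  have hconst : ∀ s : ℝ, ∫ φ, G s φ = ∫ φ, G 0 φ := fun s => by rw [hzero_s s, hzero_s 0]
  -- the Gaussian majorant `bound`, uniform for `s` in the unit ball
  set a : ℝ := M2 * w / 2 with ha_def
  have ha : 0 < a := by positivity
  have hKB := pairBoundV_nonneg w c B
  have hKL := pairBoundV_nonneg w c (grad c lam)
  have hKD := dotBound_nonneg C η w c B lam
  set M : ℝ := |c * η * C.e| * pairBoundV w c B * pairBoundV w c (grad c lam) + dotBound C η w c B lam with hM_def
  set bound : Cfg P j N → ℝ := fun φ => M * (Real.exp (4 * ‖φ‖) * Real.exp (-a * ∑ x : Site P j, ‖φ x‖ ^ 2)) with hbound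
  have hbound_int : Integrable bound := (integrable_explin_mul_gauss (P := P) (j := j) (N := N) 4 ha).const_mul M
  have hsq_exp : ∀ φ : Cfg P j N, ‖φ‖ ^ 2 ≤ Real.exp (2 * ‖φ‖) := fun φ => by
    have h1 : ‖φ‖ ≤ Real.exp ‖φ‖ := by linarith [Real.add_one_le_exp ‖φ‖]
    calc ‖φ‖ ^ 2 ≤ Real.exp ‖φ‖ ^ 2 := pow_le_pow_left₀ (norm_nonneg _) h1 2
      _ = Real.exp (2 * ‖φ‖) := by rw [← Real.exp_nat_mul]; norm_num
  have hsq4 : ∀ φ : Cfg P j N, ‖φ‖ ^ 2 * ‖φ‖ ^ 2 ≤ Real.exp (4 * ‖φ‖) := fun φ => by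
    have h := mul_le_mul (hsq_exp φ) (hsq_exp φ) (sq_nonneg _) (Real.exp_pos _).le
    rwa [← Real.exp_add, show 2 * ‖φ‖ + 2 * ‖φ‖ = 4 * ‖φ‖ by ring] at h
  have hsq2 : ∀ φ : Cfg P j N, ‖φ‖ ^ 2 ≤ Real.exp (4 * ‖φ‖) := fun φ =>
    (hsq_exp φ).trans (Real.exp_le_exp.mpr (by nlinarith [norm_nonneg φ]))
  have hwt : ∀ (s : ℝ) (φ : Cfg P j N), weight C η w c M2 (s • B) φ ≤ Real.exp (-a * ∑ x : Site P j, ‖φ x‖ ^ 2) :=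
    fun s φ => weight_le_gauss hw.le _ φ
  have h_bound : ∀ᵐ φ ∂(volume : Measure (Cfg P j N)), ∀ s ∈ Metric.ball (0 : ℝ) 1, ‖G' s φ‖ ≤ bound φ := by
    refine Filter.Eventually.of_forall fun φ s _ => ?_
    have hWpos := weight_pos (C := C) (η := η) (w := w) (c := c) (M2 := M2) (s • B) φ
    set W := weight C η w c M2 (s • B) φ with hW
    set E := Real.exp (-a * ∑ x : Site P j, ‖φ x‖ ^ 2) with hE
    have hEnn : 0 ≤ E := (Real.exp_pos _).le
    have e2 : ‖G' s φ‖ ≤ |c * η * C.e| * (W * |pairJ C η w c (s • B) B φ|) * |pairDA C η w c (s • B) lam φ|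
        + W * |pairDAdot C η w c (s • B) B lam φ| := by
      simp only [hG', Real.norm_eq_abs]
      refine (abs_add_le _ _).trans (le_of_eq ?_)
      rw [abs_mul, abs_mul, abs_mul, abs_mul, abs_neg, abs_of_pos hWpos]
    have t1 : |c * η * C.e| * (W * |pairJ C η w c (s • B) B φ|) * |pairDA C η w c (s • B) lam φ|
        ≤ |c * η * C.e| * (E * (pairBoundV w c B * ‖φ‖ ^ 2)) * (pairBoundV w c (grad c lam) * ‖φ‖ ^ 2) := by
      refine mul_le_mul (mul_le_mul_of_nonneg_left ?_ (abs_nonneg _)) ?_ (abs_nonneg _) (by positivity)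
      · exact mul_le_mul (hwt s φ) (abs_pairJ_le C η w c (s • B) B φ) (abs_nonneg _) hEnn
      · rw [pairDA_eq_pairJ]
        exact abs_pairJ_le C η w c (s • B) (grad c lam) φ
    have t2 : W * |pairDAdot C η w c (s • B) B lam φ| ≤ E * (dotBound C η w c B lam * ‖φ‖ ^ 2) :=
      mul_le_mul (hwt s φ) (abs_pairDAdot_le C η w c (s • B) B lam φ) (abs_nonneg _) hEnn
    refine e2.trans ((add_le_add t1 t2).trans ?_)
    simp only [hbound]
    have t3 : |c * η * C.e| * pairBoundV w c B * pairBoundV w c (grad c lam) * (‖φ‖ ^ 2 * ‖φ‖ ^ 2) * E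
        ≤ |c * η * C.e| * pairBoundV w c B * pairBoundV w c (grad c lam) * Real.exp (4 * ‖φ‖) * E :=
      mul_le_mul_of_nonneg_right (mul_le_mul_of_nonneg_left (hsq4 φ) (by positivity)) hEnn
    have t4 : dotBound C η w c B lam * ‖φ‖ ^ 2 * E ≤ dotBound C η w c B lam * Real.exp (4 * ‖φ‖) * E :=
      mul_le_mul_of_nonneg_right (mul_le_mul_of_nonneg_left (hsq2 φ) hKD) hEnn
    calc |c * η * C.e| * (E * (pairBoundV w c B * ‖φ‖ ^ 2)) * (pairBoundV w c (grad c lam) * ‖φ‖ ^ 2)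
          + E * (dotBound C η w c B lam * ‖φ‖ ^ 2)
        = |c * η * C.e| * pairBoundV w c B * pairBoundV w c (grad c lam) * (‖φ‖ ^ 2 * ‖φ‖ ^ 2) * E
          + dotBound C η w c B lam * ‖φ‖ ^ 2 * E := by ring
      _ ≤ |c * η * C.e| * pairBoundV w c B * pairBoundV w c (grad c lam) * Real.exp (4 * ‖φ‖) * E
          + dotBound C η w c B lam * Real.exp (4 * ‖φ‖) * E := add_le_add t3 t4
      _ = M * (Real.exp (4 * ‖φ‖) * E) := by rw [hM_def]; ring
  have h_diff : ∀ᵐ φ ∂(volume : Measure (Cfg P j N)), ∀ s ∈ Metric.ball (0 : ℝ) 1, HasDerivAt (G · φ) (G' s φ) s := by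
    refine Filter.Eventually.of_forall fun φ s _ => ?_
    simp only [hG, hG']
    exact (hasDerivAt_weight_lin C η w c M2 B φ s).mul (hasDerivAt_pairDA_lin C η w c B lam φ s)
  have hG_meas : ∀ s : ℝ, AEStronglyMeasurable (G s) (volume : Measure (Cfg P j N)) := fun s =>
    ((continuous_weight C η w c M2 _).mul (continuous_pairDA C η w c _ lam)).aestronglyMeasurable
  have hG'_meas : AEStronglyMeasurable (G' 0) (volume : Measure (Cfg P j N)) :=
    (((continuous_const.mul ((continuous_weight C η w c M2 _).mul (continuous_pairJ C η w c _ B))).mul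
      (continuous_pairDA C η w c _ lam)).add ((continuous_weight C η w c M2 _).mul (continuous_pairDAdot C η w c _ B lam))).aestronglyMeasurable
  have hG_int : Integrable (G 0) (volume : Measure (Cfg P j N)) := by
    refine ((integrable_explin_mul_gauss (P := P) (j := j) (N := N) 2 ha).const_mul (pairBoundV w c (grad c lam))).mono' (hG_meas 0)
      (Filter.Eventually.of_forall fun φ => ?_)
    have hWpos := weight_pos (C := C) (η := η) (w := w) (c := c) (M2 := M2) ((0 : ℝ) • B) φ
    have e3 : ‖G 0 φ‖ = weight C η w c M2 ((0 : ℝ) • B) φ * |pairDA C η w c ((0 : ℝ) • B) lam φ| := by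
      simp only [hG, Real.norm_eq_abs, abs_mul, abs_of_pos hWpos]
    rw [e3]
    have h2 : |pairDA C η w c ((0 : ℝ) • B) lam φ| ≤ pairBoundV w c (grad c lam) * ‖φ‖ ^ 2 := by
      rw [pairDA_eq_pairJ]
      exact abs_pairJ_le C η w c _ (grad c lam) φ
    calc weight C η w c M2 ((0 : ℝ) • B) φ * |pairDA C η w c ((0 : ℝ) • B) lam φ|
        ≤ Real.exp (-a * ∑ x : Site P j, ‖φ x‖ ^ 2) * (pairBoundV w c (grad c lam) * Real.exp (2 * ‖φ‖)) :=
          mul_le_mul (hwt 0 φ) (h2.trans (mul_le_mul_of_nonneg_left (hsq_exp φ) hKL)) (abs_nonneg _) (Real.exp_pos _).le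
      _ = pairBoundV w c (grad c lam) * (Real.exp (2 * ‖φ‖) * Real.exp (-a * ∑ x : Site P j, ‖φ x‖ ^ 2)) := by ring
  -- differentiation under the integral sign, and `f' = 0` for the constant family
  have hD := (hasDerivAt_integral_of_dominated_loc_of_deriv_le (Metric.ball_mem_nhds (0 : ℝ) one_pos)
    (Filter.Eventually.of_forall hG_meas) hG_int hG'_meas h_bound hbound_int h_diff).2
  have hzero := B3Sect2StatementsPart2.deriv_eq_zero_of_invariant hconst hD
  have hint : ∫ φ, G' 0 φ = ∫ φ, weight C η w c M2 (0 : VecField P j ℝ) φ *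
      ((-(c * η * C.e) * curJ C w c B φ) * pairD C w c lam φ - (c * η * C.e) * locQ C w c B lam φ
        - (η * C.e) * derQ C w c B lam φ) := by
    refine integral_congr_ae (Filter.Eventually.of_forall fun φ => ?_)
    simp only [hG', zero_smul]
    rw [pairJ_zero, pairDA_zero, pairDAdot_zero]
    ring
  rw [hint] at hzero
  exact hzero

/-- **normal (Wick) ordering** with respect to `dμ_{C^η_{M²}}` of a functional of the field: `:X: = X − ∫dμ_{C^η_{M²}}X`.
[cite: Balaban1983Higgs3, (2.26) p.431] -/
def normOrd (X : Cfg P j N → ℝ) (φ : Cfg P j N) : ℝ :=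
  X φ - (∫ ψ, weight C η w c M2 (0 : VecField P j ℝ) ψ * X ψ) / ∫ ψ, weight C η w c M2 (0 : VecField P j ℝ) ψ

/-- *"using the identity (2.25)"*: `:⟨∂^ηφ, ∂^ηλqφ⟩: = ⟨∂^ηφ, ∂^ηλqφ⟩` (its `dμ_C`-mean vanishes by (2.25), `B3WT224Instance.eq225`).
[cite: Balaban1983Higgs3, (2.26) p.431] -/
theorem normOrd_pairD (hw : 0 < w) (hM : 0 < M2) (hce : c * η * C.e ≠ 0) (lam : Site P j → ℝ) :
    normOrd C η w c M2 (pairD C w c lam) = pairD C w c lam := by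
  funext φ
  rw [normOrd, eq225 C η w c M2 hw hM hce lam, zero_div, sub_zero]

/-- **(2.26) p. 431 [PDF 21], LEFT MEMBER, for the concrete lattice model**: with `dμ_{C^η_{M²}}(φ) = Z⁻¹e^{−½⟨φ,(−Δ^η+M²)φ⟩}dφ`,
`∫dμ_{C^η_{M²}}(φ)[(−cηe⟨∂^ηφ, Bqφ⟩)(:⟨∂^ηφ, ∂^ηλqφ⟩:) − cηe⟨φ, B·∂^ηλq²φ⟩ − ηe⟨∂^ηφ, B∂^ηλq²φ⟩] = 0`
for every direction `B` of the vector field and every gauge function `λ` (`η^d = w > 0`, `M² > 0`, `cηe ≠ 0`; print: `e_k = e(L^kε)`,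
`cη = 1`).  The printed RIGHT member (the four trace terms) is the Wick evaluation of the same three integrals and is NOT computed
here. [cite: Balaban1983Higgs3, (2.26) p.431] -/
theorem eq226_left (hw : 0 < w) (hM : 0 < M2) (hce : c * η * C.e ≠ 0) (B : VecField P j ℝ) (lam : Site P j → ℝ) :
    (∫ φ, weight C η w c M2 (0 : VecField P j ℝ) φ *
      ((-(c * η * C.e) * curJ C w c B φ) * normOrd C η w c M2 (pairD C w c lam) φ - (c * η * C.e) * locQ C w c B lam φ
        - (η * C.e) * derQ C w c B lam φ)) / ∫ φ, weight C η w c M2 (0 : VecField P j ℝ) φ = 0 := by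
  rw [normOrd_pairD C η w c M2 hw hM hce lam, eq226_deriv C η w c M2 hw hM hce B lam, zero_div]

/-- (2.26), left member, phrased with the normalized mean `meanC = ∫dμ_{C^η_{M²}}` of r15's carrier instance
`B3WT224Instance.wtModel` (*"where now the propagators are C^η_{M²}"*). [cite: Balaban1983Higgs3, (2.26) p.431] -/
theorem eq226_left_meanC (hw : 0 < w) (hM : 0 < M2) (hce : c * η * C.e ≠ 0) (A B : VecField P j ℝ) (lam : Site P j → ℝ) :
    (wtModel C η w c M2 A).meanC (fun φ =>
      (-(c * η * C.e) * curJ C w c B φ) * normOrd C η w c M2 (pairD C w c lam) φ - (c * η * C.e) * locQ C w c B lam φ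
        - (η * C.e) * derQ C w c B lam φ) = 0 :=
  eq226_left C η w c M2 hw hM hce B lam

end Literature.MathematicalPhysics.QuantumFieldTheory.Balaban1983to89.B3WT226Derivative

end
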